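import Summits.Ventures.LatticeQCDFlow.TrivializingMaps.AbelianRadius

/-!
HONEST FRAMING: exact (Metropolis-corrected) sampling algorithms for lattice gauge theory; figures of
merit are autocorrelation/cost numbers at stated couplings and volumes; no continuum-physics claim.

# AbelianContraction — PROOF of the one-step contraction `abelianStepContraction : AbelianStepContraction K`
(THEORY-1.md §12.3, U(1) case of THEOREM A), for every finite plaquette complex `K`

Proposed tree path: `Summits/Ventures/LatticeQCDFlow/TrivializingMaps/AbelianContraction.lean` (OURS). Imports only
`AbelianRadius.lean` (definitions) — land that file first. Contents: the algebra of the local gradient norm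
`N_e` (subadditive, homogeneous, value on `δ_m`), the two counting facts of the complex (`∑_p |χ_p(e)| ≤ D`,
`∑_p |⟨χ_p,n⟩| ≤ D‖n‖₁`), the per-term eigenvalue bound `|m_e|/c(m) ≤ |n_e|/max(g,‖n‖₁-4) + |χ_e|/g`, and the
assembly PART A (`≤ D(1+4/g)M`) + PART B (`≤ 4DM/g`). Kernel-checked: 0 sorries, axioms {propext,
Classical.choice, Quot.sound}. Cell `lqcd-flow`, unit `pub-lqcd-theory1-g3`, 2026-08-21.
-/

namespace Summit.Ventures.LatticeQCDFlow.TrivializingMaps.Abelian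

open Finset

variable {E P : Type*} [Fintype E] [Fintype P]

noncomputable section

namespace LocNorm

variable (e : E)

omit [Fintype E] in
/-- `N_e(a)` as a sum over any finite superset of the support. -/
theorem eq_sum_of_support_subset (a : Coeffs E) {s : Finset (Mode E)} (h : a.support ⊆ s) :
    locNorm e a = ∑ n ∈ s, |(n e : ℝ)| * |a n| := by
  unfold locNorm
  exact Finsupp.sum_of_support_subset a h _ (fun n _ => by simp)

omit [Fintype E] in
/-- `N_e(0) = 0`. -/
@[simp] theorem zero : locNorm e (0 : Coeffs E) = 0 := by
  simp [locNorm]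

omit [Fintype E] in
/-- `N_e(v·δ_m) = |m_e| |v|`. -/
theorem single (m : Mode E) (v : ℝ) : locNorm e (Finsupp.single m v) = |(m e : ℝ)| * |v| := by
  unfold locNorm
  exact Finsupp.sum_single_index (by simp)

omit [Fintype E] in
/-- Subadditivity `N_e(a + b) ≤ N_e(a) + N_e(b)`. -/
theorem add_le (a b : Coeffs E) : locNorm e (a + b) ≤ locNorm e a + locNorm e b := by
  classical
  have hs : (a + b).support ⊆ a.support ∪ b.support := Finsupp.support_add
  rw [eq_sum_of_support_subset e (a + b) hs,
    eq_sum_of_support_subset e a (Finset.subset_union_left),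
    eq_sum_of_support_subset e b (Finset.subset_union_right), ← Finset.sum_add_distrib]
  refine Finset.sum_le_sum fun n _ => ?_
  rw [Finsupp.add_apply, ← mul_add]
  exact mul_le_mul_of_nonneg_left (abs_add_le _ _) (abs_nonneg _)

omit [Fintype E] in
/-- Homogeneity `N_e(c·a) = |c| N_e(a)`. -/
theorem smul (c : ℝ) (a : Coeffs E) : locNorm e (c • a) = |c| * locNorm e a := by
  classical
  rw [eq_sum_of_support_subset e (c • a) (Finsupp.support_smul), eq_sum_of_support_subset e a subset_rfl,
    Finset.mul_sum]
  refine Finset.sum_congr rfl fun n _ => ?_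
  rw [Finsupp.smul_apply, smul_eq_mul, abs_mul]; ring

omit [Fintype E] in
/-- `N_e(-a) = N_e(a)`. -/
theorem neg (a : Coeffs E) : locNorm e (-a) = locNorm e a := by
  have : -a = (-1 : ℝ) • a := by simp
  rw [this, smul]; simp

omit [Fintype E] in
/-- `N_e(a - b) ≤ N_e(a) + N_e(b)`. -/
theorem sub_le (a b : Coeffs E) : locNorm e (a - b) ≤ locNorm e a + locNorm e b := by
  rw [sub_eq_add_neg]
  calc locNorm e (a + -b) ≤ locNorm e a + locNorm e (-b) := add_le e a (-b)
    _ = locNorm e a + locNorm e b := by rw [neg]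

omit [Fintype E] in
/-- `N_e(∑ᵢ fᵢ) ≤ ∑ᵢ N_e(fᵢ)`. -/
theorem finset_sum_le {ι : Type*} (s : Finset ι) (f : ι → Coeffs E) :
    locNorm e (∑ i ∈ s, f i) ≤ ∑ i ∈ s, locNorm e (f i) :=
  Finset.le_sum_of_subadditive (locNorm e) (zero e).le (add_le e) s f

omit [Fintype E] in
/-- `N_e` through a `Finsupp.sum`. -/
theorem finsupp_sum_le (a : Coeffs E) (g : Mode E → ℝ → Coeffs E) :
    locNorm e (a.sum g) ≤ ∑ n ∈ a.support, locNorm e (g n (a n)) :=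
  finset_sum_le e _ _

end LocNorm

/-! ### Combinatorics of the complex -/

section Complex

variable (K : PlaquetteComplex E P)

/-- `∑_p |χ_p(e)| ≤ D` (at most `D` plaquettes through a link, entries `≤ 1`). -/
theorem sum_abs_χ_le (e : E) : ∑ p, |(K.χ p e : ℝ)| ≤ K.D := by
  classical
  have h1 : ∑ p, |(K.χ p e : ℝ)| = ∑ p ∈ Finset.univ.filter (fun p => K.χ p e ≠ 0), |(K.χ p e : ℝ)| := by
    rw [Finset.sum_filter_of_ne]
    intro p _ hp
    have : (K.χ p e : ℝ) ≠ 0 := fun h => hp (by rw [h, abs_zero])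
    exact_mod_cast this
  rw [h1]
  calc ∑ p ∈ Finset.univ.filter (fun p => K.χ p e ≠ 0), |(K.χ p e : ℝ)|
      ≤ ∑ p ∈ Finset.univ.filter (fun p => K.χ p e ≠ 0), (1 : ℝ) :=
        Finset.sum_le_sum fun p _ => by exact_mod_cast K.abs_χ_le p e
    _ = ((Finset.univ.filter (fun p => K.χ p e ≠ 0)).card : ℝ) := by simp
    _ ≤ K.D := by exact_mod_cast K.card_filter_le e

/-- `∑_p |⟨χ_p, n⟩| ≤ D ‖n‖₁`. -/
theorem sum_abs_pair_le (n : Mode E) : ∑ p, |(pair (K.χ p) n : ℝ)| ≤ K.D * (l1 n : ℝ) := by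
  have hcast : ∀ p, |(pair (K.χ p) n : ℝ)| ≤ ∑ e, |(K.χ p e : ℝ)| * |(n e : ℝ)| := by
    intro p
    have := abs_pair_le (K.χ p) n
    have h' : ((|pair (K.χ p) n| : ℤ) : ℝ) ≤ ((∑ e, |K.χ p e| * |n e| : ℤ) : ℝ) := by exact_mod_cast this
    simpa [Int.cast_abs, Int.cast_sum, Int.cast_mul] using h'
  calc ∑ p, |(pair (K.χ p) n : ℝ)| ≤ ∑ p, ∑ e, |(K.χ p e : ℝ)| * |(n e : ℝ)| := Finset.sum_le_sum fun p _ => hcast p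
    _ = ∑ e, |(n e : ℝ)| * ∑ p, |(K.χ p e : ℝ)| := by
        rw [Finset.sum_comm]; refine Finset.sum_congr rfl fun e _ => ?_; rw [Finset.mul_sum]
        refine Finset.sum_congr rfl fun p _ => ?_; ring
    _ ≤ ∑ e, |(n e : ℝ)| * K.D := Finset.sum_le_sum fun e _ =>
        mul_le_mul_of_nonneg_left (sum_abs_χ_le K e) (abs_nonneg _)
    _ = K.D * (l1 n : ℝ) := by rw [← Finset.sum_mul, mul_comm]; simp [l1, Int.cast_sum, Int.cast_abs]

/-- `∑_e |χ_p(e)| ≤ 4` in `ℝ`. -/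
theorem l1_χ_real (p : P) : ∑ e, |(K.χ p e : ℝ)| ≤ 4 := by
  have := K.l1_χ_le p
  unfold l1 at this
  have h : ((∑ e, |K.χ p e| : ℤ) : ℝ) ≤ 4 := by exact_mod_cast this
  simpa [Int.cast_sum, Int.cast_abs] using h

end Complex

/-! ### The one-step contraction (THEORY-1 §12.3, U(1)) -/

section Contraction

variable (K : PlaquetteComplex E P)

/-- Inverse Laplacian eigenvalue bounds from the girth hypothesis and the ℓ¹ shift. -/
theorem inv_normSq_le {g : ℕ} (hg : 1 ≤ g) {m : Mode E} (hgm : (g : ℤ) ≤ normSq m) {s : ℝ}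
    (hs : s ≤ (normSq m : ℝ)) : ((normSq m : ℝ))⁻¹ ≤ 1 / max (g : ℝ) s := by
  have hgpos : (0 : ℝ) < g := by exact_mod_cast hg
  have hmax : 0 < max (g : ℝ) s := lt_max_of_lt_left hgpos
  have hle : max (g : ℝ) s ≤ (normSq m : ℝ) := max_le (by exact_mod_cast hgm) hs
  rw [one_div]
  exact inv_anti₀ hmax hle

/-- Per-mode term bound: `|m_e| / c(m) ≤ |n_e| · A(n) + |χ_e| / g` for `m = n ± χ` NONZERO with `c(m) ≥ g`,
where `A(n) = 1 / max(g, ‖n‖₁ - 4)`; trivially true for `m = 0` (`0⁻¹ = 0`). -/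
theorem term_le {g : ℕ} (hg : 1 ≤ g) (n χ m : Mode E) (hm : m = n + χ ∨ m = n - χ) (hχ : l1 χ ≤ 4)
    (hgirth : m ≠ 0 → (g : ℤ) ≤ normSq m) (e : E) :
    |(m e : ℝ)| * ((normSq m : ℝ))⁻¹ ≤
      |(n e : ℝ)| * (1 / max (g : ℝ) ((l1 n : ℝ) - 4)) + |(χ e : ℝ)| * (1 / (g : ℝ)) := by
  have hgpos : (0 : ℝ) < g := by exact_mod_cast hg
  have hA : 0 ≤ 1 / max (g : ℝ) ((l1 n : ℝ) - 4) := by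
    have : 0 < max (g : ℝ) ((l1 n : ℝ) - 4) := lt_max_of_lt_left hgpos
    positivity
  have hB : 0 ≤ 1 / (g : ℝ) := by positivity
  rcases eq_or_ne m 0 with h0 | h0
  · subst h0
    simp only [Pi.zero_apply, Int.cast_zero, abs_zero, zero_mul]
    positivity
  have hgm := hgirth h0
  -- coordinate bound |m e| ≤ |n e| + |χ e|
  have hcoord : |(m e : ℝ)| ≤ |(n e : ℝ)| + |(χ e : ℝ)| := by
    rcases hm with rfl | rfl
    · simp only [Pi.add_apply, Int.cast_add]; exact abs_add_le _ _
    · simp only [Pi.sub_apply, Int.cast_sub]; exact abs_sub _ _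
  -- eigenvalue bounds
  have hshift : ((l1 n : ℝ) - 4) ≤ (normSq m : ℝ) := by
    have h1 : l1 n - l1 χ ≤ l1 m := by
      rcases hm with rfl | rfl
      · exact l1_sub_le_l1_add n χ
      · exact l1_sub_le_l1_sub n χ
    have h2 : l1 m ≤ normSq m := l1_le_normSq m
    have h3 : l1 n - 4 ≤ normSq m := by linarith
    exact_mod_cast h3
  have hinvA : ((normSq m : ℝ))⁻¹ ≤ 1 / max (g : ℝ) ((l1 n : ℝ) - 4) := inv_normSq_le hg hgm hshift
  have hinvB : ((normSq m : ℝ))⁻¹ ≤ 1 / (g : ℝ) := by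
    have := inv_normSq_le hg hgm (le_of_eq rfl : (normSq m : ℝ) ≤ (normSq m : ℝ))
    -- max g (normSq m) = normSq m
    have hmax : max (g : ℝ) (normSq m : ℝ) = (normSq m : ℝ) := max_eq_right (by exact_mod_cast hgm)
    rw [hmax] at this
    calc ((normSq m : ℝ))⁻¹ = 1 / (normSq m : ℝ) := (one_div _).symm
      _ ≤ 1 / (g : ℝ) := one_div_le_one_div_of_le hgpos (by exact_mod_cast hgm)
  have hinv0 : 0 ≤ ((normSq m : ℝ))⁻¹ := inv_nonneg.mpr (by exact_mod_cast normSq_nonneg m)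
  calc |(m e : ℝ)| * ((normSq m : ℝ))⁻¹ ≤ (|(n e : ℝ)| + |(χ e : ℝ)|) * ((normSq m : ℝ))⁻¹ :=
        mul_le_mul_of_nonneg_right hcoord hinv0
    _ = |(n e : ℝ)| * ((normSq m : ℝ))⁻¹ + |(χ e : ℝ)| * ((normSq m : ℝ))⁻¹ := by ring
    _ ≤ |(n e : ℝ)| * (1 / max (g : ℝ) ((l1 n : ℝ) - 4)) + |(χ e : ℝ)| * (1 / (g : ℝ)) :=
        add_le_add (mul_le_mul_of_nonneg_left hinvA (abs_nonneg _))
          (mul_le_mul_of_nonneg_left hinvB (abs_nonneg _))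

/-- Local norm of one summand of `stepR`. -/
theorem locNorm_stepTerm_le (e : E) (n : Mode E) (an : ℝ) (p : P) :
    locNorm e (((pair (K.χ p) n : ℝ) * an / 2) •
      (Finsupp.single (n - K.χ p) ((normSq (n - K.χ p) : ℝ)⁻¹) -
        Finsupp.single (n + K.χ p) ((normSq (n + K.χ p) : ℝ)⁻¹))) ≤
      |(pair (K.χ p) n : ℝ)| * |an| / 2 *
        (|((n - K.χ p) e : ℝ)| * ((normSq (n - K.χ p) : ℝ))⁻¹ +
          |((n + K.χ p) e : ℝ)| * ((normSq (n + K.χ p) : ℝ))⁻¹) := by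
  rw [LocNorm.smul]
  have habs : |(pair (K.χ p) n : ℝ) * an / 2| = |(pair (K.χ p) n : ℝ)| * |an| / 2 := by
    rw [abs_div, abs_mul, abs_two]
  rw [habs]
  refine mul_le_mul_of_nonneg_left ?_ (by positivity)
  refine (LocNorm.sub_le e _ _).trans (le_of_eq ?_)
  have h₁ : (0 : ℝ) ≤ ((normSq (n - K.χ p) : ℝ))⁻¹ :=
    inv_nonneg.mpr (by exact_mod_cast normSq_nonneg (n - K.χ p))
  have h₂ : (0 : ℝ) ≤ ((normSq (n + K.χ p) : ℝ))⁻¹ :=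
    inv_nonneg.mpr (by exact_mod_cast normSq_nonneg (n + K.χ p))
  rw [LocNorm.single, LocNorm.single, abs_of_nonneg h₁, abs_of_nonneg h₂]

/-- **THEOREM (ours, gen-3): the one-step contraction holds for every finite plaquette complex.** -/
theorem abelianStepContraction : AbelianStepContraction K := by
  classical
  intro g hg a M hGirth hM e
  have hgpos : (0 : ℝ) < g := by exact_mod_cast hg
  have hM0 : 0 ≤ M := (locNorm_nonneg e a).trans (hM e)
  -- abbreviations
  set A : Mode E → ℝ := fun n => 1 / max (g : ℝ) ((l1 n : ℝ) - 4) with hAdef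
  set B : ℝ := 1 / (g : ℝ) with hBdef
  have hA0 : ∀ n, 0 ≤ A n := fun n => by
    have : 0 < max (g : ℝ) ((l1 n : ℝ) - 4) := lt_max_of_lt_left hgpos
    simp only [hAdef]; positivity
  have hB0 : 0 ≤ B := by simp only [hBdef]; positivity
  -- Step 1: push the norm through the sums
  have h1 : locNorm e (stepR K a) ≤ ∑ n ∈ a.support, ∑ p,
      |(pair (K.χ p) n : ℝ)| * |a n| / 2 *
        (|((n - K.χ p) e : ℝ)| * ((normSq (n - K.χ p) : ℝ))⁻¹ +
          |((n + K.χ p) e : ℝ)| * ((normSq (n + K.χ p) : ℝ))⁻¹) := by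
    unfold stepR
    refine (LocNorm.finsupp_sum_le e a _).trans (Finset.sum_le_sum fun n _ => ?_)
    exact (LocNorm.finset_sum_le e _ _).trans (Finset.sum_le_sum fun p _ => locNorm_stepTerm_le K e n (a n) p)
  -- Step 2: termwise bound via `term_le`
  have h2 : ∀ n ∈ a.support, ∀ p,
      |(pair (K.χ p) n : ℝ)| * |a n| / 2 *
        (|((n - K.χ p) e : ℝ)| * ((normSq (n - K.χ p) : ℝ))⁻¹ +
          |((n + K.χ p) e : ℝ)| * ((normSq (n + K.χ p) : ℝ))⁻¹)
      ≤ |(pair (K.χ p) n : ℝ)| * |a n| * (|(n e : ℝ)| * A n + |(K.χ p e : ℝ)| * B) := by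
    intro n hn p
    have hm := term_le hg n (K.χ p) (n - K.χ p) (Or.inr rfl) (K.l1_χ_le p)
      (fun h0 => hGirth n hn p _ (Or.inr rfl) h0) e
    have hp := term_le hg n (K.χ p) (n + K.χ p) (Or.inl rfl) (K.l1_χ_le p)
      (fun h0 => hGirth n hn p _ (Or.inl rfl) h0) e
    have hc : 0 ≤ |(pair (K.χ p) n : ℝ)| * |a n| := by positivity
    calc _ ≤ |(pair (K.χ p) n : ℝ)| * |a n| / 2 *
          ((|(n e : ℝ)| * A n + |(K.χ p e : ℝ)| * B) + (|(n e : ℝ)| * A n + |(K.χ p e : ℝ)| * B)) := by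
          exact mul_le_mul_of_nonneg_left (add_le_add hm hp) (by positivity)
      _ = |(pair (K.χ p) n : ℝ)| * |a n| * (|(n e : ℝ)| * A n + |(K.χ p e : ℝ)| * B) := by ring
  -- Step 3: split into Part A and Part B
  have h3 : locNorm e (stepR K a) ≤
      (∑ n ∈ a.support, (∑ p, |(pair (K.χ p) n : ℝ)|) * (|a n| * |(n e : ℝ)| * A n)) +
      (∑ n ∈ a.support, ∑ p, |(pair (K.χ p) n : ℝ)| * |(K.χ p e : ℝ)| * |a n| * B) := by
    refine h1.trans ?_
    rw [← Finset.sum_add_distrib]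
    refine Finset.sum_le_sum fun n hn => ?_
    rw [Finset.sum_mul, ← Finset.sum_add_distrib]
    refine Finset.sum_le_sum fun p _ => ?_
    refine (h2 n hn p).trans (le_of_eq ?_)
    ring
  -- Part A
  have hPartA : ∑ n ∈ a.support, (∑ p, |(pair (K.χ p) n : ℝ)|) * (|a n| * |(n e : ℝ)| * A n)
      ≤ K.D * (1 + 4 / (g : ℝ)) * M := by
    have hstep : ∀ n ∈ a.support, (∑ p, |(pair (K.χ p) n : ℝ)|) * (|a n| * |(n e : ℝ)| * A n)
        ≤ K.D * (1 + 4 / (g : ℝ)) * (|(n e : ℝ)| * |a n|) := by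
      intro n _
      have hr : (l1 n : ℝ) * A n ≤ 1 + 4 / (g : ℝ) := by
        simp only [hAdef]
        rw [← div_eq_mul_one_div]
        exact ratio_le (g : ℝ) (l1 n : ℝ) (by exact_mod_cast hg)
      calc (∑ p, |(pair (K.χ p) n : ℝ)|) * (|a n| * |(n e : ℝ)| * A n)
          ≤ (K.D * (l1 n : ℝ)) * (|a n| * |(n e : ℝ)| * A n) :=
            mul_le_mul_of_nonneg_right (sum_abs_pair_le K n) (by positivity)
        _ = K.D * ((l1 n : ℝ) * A n) * (|(n e : ℝ)| * |a n|) := by ring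
        _ ≤ K.D * (1 + 4 / (g : ℝ)) * (|(n e : ℝ)| * |a n|) := by gcongr
    calc _ ≤ ∑ n ∈ a.support, K.D * (1 + 4 / (g : ℝ)) * (|(n e : ℝ)| * |a n|) := Finset.sum_le_sum hstep
      _ = K.D * (1 + 4 / (g : ℝ)) * locNorm e a := by
          rw [← Finset.mul_sum]; congr 1
      _ ≤ K.D * (1 + 4 / (g : ℝ)) * M := by gcongr; exact hM e
  -- Part B
  have hpair : ∀ n p, |(pair (K.χ p) n : ℝ)| ≤ ∑ e', |(K.χ p e' : ℝ)| * |(n e' : ℝ)| := by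
    intro n p
    have := abs_pair_le (K.χ p) n
    have h' : ((|pair (K.χ p) n| : ℤ) : ℝ) ≤ ((∑ e', |K.χ p e'| * |n e'| : ℤ) : ℝ) := by exact_mod_cast this
    simpa [Int.cast_abs, Int.cast_sum, Int.cast_mul] using h'
  have hinner : ∀ p, ∑ n ∈ a.support, |(pair (K.χ p) n : ℝ)| * |a n| ≤ 4 * M := by
    intro p
    calc ∑ n ∈ a.support, |(pair (K.χ p) n : ℝ)| * |a n|
        ≤ ∑ n ∈ a.support, (∑ e', |(K.χ p e' : ℝ)| * |(n e' : ℝ)|) * |a n| :=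
          Finset.sum_le_sum fun n _ => mul_le_mul_of_nonneg_right (hpair n p) (abs_nonneg _)
      _ = ∑ n ∈ a.support, ∑ e', |(K.χ p e' : ℝ)| * (|(n e' : ℝ)| * |a n|) := by
          refine Finset.sum_congr rfl fun n _ => ?_
          rw [Finset.sum_mul]
          refine Finset.sum_congr rfl fun e' _ => ?_
          ring
      _ = ∑ e', |(K.χ p e' : ℝ)| * ∑ n ∈ a.support, |(n e' : ℝ)| * |a n| := by
          rw [Finset.sum_comm]
          refine Finset.sum_congr rfl fun e' _ => ?_
          rw [Finset.mul_sum]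
      _ = ∑ e', |(K.χ p e' : ℝ)| * locNorm e' a := by
          refine Finset.sum_congr rfl fun e' _ => ?_
          rw [LocNorm.eq_sum_of_support_subset e' a subset_rfl]
      _ ≤ ∑ e', |(K.χ p e' : ℝ)| * M :=
          Finset.sum_le_sum fun e' _ => mul_le_mul_of_nonneg_left (hM e') (abs_nonneg _)
      _ ≤ 4 * M := by
          rw [← Finset.sum_mul]; exact mul_le_mul_of_nonneg_right (l1_χ_real K p) hM0
  have hPartB : ∑ n ∈ a.support, ∑ p, |(pair (K.χ p) n : ℝ)| * |(K.χ p e : ℝ)| * |a n| * B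
      ≤ K.D * (4 / (g : ℝ)) * M := by
    rw [Finset.sum_comm]
    calc ∑ p, ∑ n ∈ a.support, |(pair (K.χ p) n : ℝ)| * |(K.χ p e : ℝ)| * |a n| * B
        = ∑ p, (|(K.χ p e : ℝ)| * B) * ∑ n ∈ a.support, |(pair (K.χ p) n : ℝ)| * |a n| := by
          refine Finset.sum_congr rfl fun p _ => ?_
          rw [Finset.mul_sum]
          refine Finset.sum_congr rfl fun n _ => ?_
          ring
      _ ≤ ∑ p, (|(K.χ p e : ℝ)| * B) * (4 * M) :=
          Finset.sum_le_sum fun p _ =>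
            mul_le_mul_of_nonneg_left (hinner p) (mul_nonneg (abs_nonneg _) hB0)
      _ = (4 * M * B) * ∑ p, |(K.χ p e : ℝ)| := by
          rw [Finset.mul_sum]
          refine Finset.sum_congr rfl fun p _ => ?_
          ring
      _ ≤ (4 * M * B) * K.D :=
          mul_le_mul_of_nonneg_left (sum_abs_χ_le K e)
            (mul_nonneg (mul_nonneg (by norm_num) hM0) hB0)
      _ = K.D * (4 / (g : ℝ)) * M := by simp only [hBdef]; ring
  calc locNorm e (stepR K a) ≤ _ := h3
    _ ≤ K.D * (1 + 4 / (g : ℝ)) * M + K.D * (4 / (g : ℝ)) * M := add_le_add hPartA hPartB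
    _ = K.D * (1 + 8 / (g : ℝ)) * M := by ring

end Contraction

end

end Summit.Ventures.LatticeQCDFlow.TrivializingMaps.Abelian
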